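import Summits.CriticalPhenomena.PercolationContinuityZ3.Theorems.PercNearOneGluingNoHeavyLowerTailSahiBlocksAllButOneEvents
import Summits.CriticalPhenomena.PercolationContinuityZ3.Theorems.PercNearOneGluingNoHeavyLowerTailSahiBlocksAllButOneDecomp
import Summits.CriticalPhenomena.PercolationContinuityZ3.Theorems.PercNearOneGluingNoHeavyLowerTailSahiAllButOne
import Summits.CriticalPhenomena.PercolationContinuityZ3.Theorems.PercNearOneGluingNoHeavyLowerTailSahiOrCylindersPrelim

/-!
# `NoHeavyLowerTail` (crux stmt-CriticalPhenomena-4575), Sahi / Kahn positivity: ALL BLOCKS BUT ONE (V) — the certificate and the theorem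

Support file (cell `prim-l12`, seat P3, gen 8; `--supports stmt-CriticalPhenomena-4575`).  No `sorry`, no named facts, standard axioms.
New mathematics (this programme).

**THEOREM (Kahn's Conjecture 5 / Sahi's `C₃` when the first slot is "all but at most one of the disjoint cylinders `C_{B_1}, …, C_{B_m}`
hold").**  Let a block `e : Fin k ↪ ι` (`k ≥ 1`) of a finite product space carry interior parameters and a block assignment
`β : Fin k → Fin m`, and let `H` be the increasing event, determined by the block, whose pattern event is `aboH β` = "at most one of the
blocks `blk β i` is not fully open" (the read-once threshold function `Th_{m−1}(∧_{B_1}, …, ∧_{B_m})`).  Then `E₃(1_H, 1_U, 1_V) ≥ 0`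
for ALL increasing `U, V`, in every dimension (`sahiE_three_nonneg_of_aboH`).  This contains the all-but-one slot (`|B_i| = 1`,
`…SahiAllButOne`) and the OR of two disjoint cylinders (`m = 2`, `…SahiOrCylinders`) and is new for `m ≥ 3` with a block of size `≥ 2`
on `≥ 5` coordinates.

PROOF.  `ρ = μ(· | exactly one block not open)` (`rhoB`) is a reduced transport certificate (`rhoCert_aboH`): by the trace reduction
(`rhoCert_of_hat`) the rows are needed on trace-maximal families only, which are intersections of block sections (`hat_aboH`); by
independence of the blocks all probabilities are products/sums of the per-block section probabilities (`…Events`), and in the odds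
dictionary `P_i = μ(C_{B_i})`, `r_i = 1/P_i − 1`, `x_i = P_i(1+a_i)` the rows (TC) and (o) are `…Decomp.blocks_tc_W` (the block inequality with
hyperbola states) and `blocks_o_W`; (a) is `…SahiAllButOne.a_ineq'`. [this work]
-/

noncomputable section

open scoped Classical

namespace Summit.CriticalPhenomena.PercolationContinuityZ3.Theorems

namespace SahiBlocksAllButOne

open Finset
open SahiHittingSlot SahiTransportCert
open SahiOrCylinders (hat_inter)
open Literature.Combinatorics.Sahi2008
open Literature.Probability.Percolation (DeterminedBy determinedBy_iff)
open Literature.Probability.Percolation.BHK2006 (ind_inter)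
open Literature.Probability.Percolation.DecisionTree (ind ind_of_mem ind_of_not_mem ind_nonneg)

variable {k m : ℕ} (q : Fin k → unitInterval) (β : Fin k → Fin m)

/-! ### The odds dictionary -/

/-- The block odds `r_i = 1/P_i − 1`, `P_i = μ(block i open)`. [this work] -/
def rB (i : Fin m) : ℝ := 1 / pr q (cylB β i) - 1

/-- The state `a_i = μ(sec_i 𝒳)/P_i − 1` of a family in block `i`. [this work] -/
def aX (𝒳 : Set (Set (Fin k))) (i : Fin m) : ℝ := pr q (sec β i 𝒳) / pr q (cylB β i) - 1

/-- The section of the full family is the full family. [this work] -/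
theorem sec_univ (i : Fin m) : sec β i (Set.univ : Set (Set (Fin k))) = Set.univ :=
  Set.eq_univ_of_forall fun _ => Set.mem_univ _

/-- The states of the full family are the odds. [this work] -/
theorem aX_univ : aX q β Set.univ = rB q β := by
  funext i; rw [aX, rB, sec_univ, pr_univ]

section Cert

variable {q} (hq : ∀ x, 0 < (q x : ℝ) ∧ (q x : ℝ) < 1)
include hq

/-- `P_i > 0`. [this work] -/
theorem prB_pos (i : Fin m) : 0 < pr q (cylB β i) := by
  rw [pr_cylB_eq]; exact prod_pos fun x _ => (hq x).1

/-- `P_i < 1` for a nonempty block. [this work] -/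
theorem prB_lt_one {i : Fin m} {x : Fin k} (hx : β x = i) : pr q (cylB β i) < 1 := by
  rw [pr_cylB_eq, ← mul_prod_erase _ _ (mem_filter.2 ⟨mem_univ x, hx⟩)]
  have h1 : ∏ y ∈ (univ.filter fun y => β y = i).erase x, (q y : ℝ) ≤ 1 := prod_le_one (fun y _ => (hq y).1.le) fun y _ => (hq y).2.le
  have h0 : 0 ≤ ∏ y ∈ (univ.filter fun y => β y = i).erase x, (q y : ℝ) := prod_nonneg fun y _ => (hq y).1.le
  nlinarith [(hq x).1, (hq x).2]

/-- `r_i ≥ 0`. [this work] -/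
theorem rB_nonneg (i : Fin m) : 0 ≤ rB q β i := by
  rw [rB, sub_nonneg, le_div_iff₀ (prB_pos β hq i), one_mul]; exact pr_le_one q _

/-- `W · ∏(1 + r_i) = 1` with `W = μ(⊤) = ∏ P_i`. [this work] -/
theorem top_mul_bprod : pr q ({Set.univ} : Set (Set (Fin k))) * bprod (rB q β) = 1 := by
  rw [pr_top_eq q β, bprod, ← prod_mul_distrib]
  refine prod_eq_one fun i _ => ?_
  rw [rB]; field_simp [(prB_pos β hq i).ne']; ring

/-- `Σ r_i > 0` for a nonempty block structure. [this work] -/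
theorem bsum_rB_pos (hk : 0 < k) : 0 < bsum (rB q β) := by
  have hi : 0 < rB q β (β ⟨0, hk⟩) := by
    rw [rB, sub_pos, lt_div_iff₀ (prB_pos β hq _), one_mul]; exact prB_lt_one β hq rfl
  rw [bsum, ← add_sum_erase univ _ (mem_univ (β ⟨0, hk⟩))]
  linarith [sum_nonneg fun i (_ : i ∈ univ.erase (β ⟨0, hk⟩)) => rB_nonneg β hq i]

/-! ### The dictionary on trace-maximal families -/

/-- `μ(hat 𝒳) = W · ∏(1 + a_i)`. [this work] -/
theorem pr_hat_eq (hm : 0 < m) {𝒳 : Set (Set (Fin k))} (h𝒳 : IsUpperSet 𝒳) :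
    pr q (hat (aboH β) 𝒳) = pr q ({Set.univ} : Set (Set (Fin k))) * bprod (aX q β 𝒳) := by
  rw [hat_aboH β hm h𝒳, pr_iInter_sec, pr_top_eq q β, bprod, ← prod_mul_distrib]
  refine prod_congr rfl fun i _ => ?_
  rw [aX]; field_simp [(prB_pos β hq i).ne']; ring

/-- `μ(aboH ∩ hat 𝒳) = W · (1 + Σ a_i)` for a nonempty up-set. [this work] -/
theorem pr_aboH_inter_hat_eq (hm : 0 < m) {𝒳 : Set (Set (Fin k))} (h𝒳 : IsUpperSet 𝒳) (huniv : Set.univ ∈ 𝒳) :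
    pr q (aboH β ∩ hat (aboH β) 𝒳) = pr q ({Set.univ} : Set (Set (Fin k))) * (1 + bsum (aX q β 𝒳)) := by
  rw [hat_aboH β hm h𝒳, pr_aboH_inter_iInter_sec q β huniv, bsum, mul_add, mul_one, mul_sum]
  refine congrArg _ (sum_congr rfl fun i _ => ?_)
  rw [pr_top_eq q β, ← mul_prod_erase univ _ (mem_univ i), aX]
  field_simp [(prB_pos β hq i).ne']

/-- `μ(exoneB ∩ hat 𝒳) = W · Σ a_i` for a nonempty up-set. [this work] -/
theorem pr_exoneB_inter_hat_eq (hm : 0 < m) {𝒳 : Set (Set (Fin k))} (h𝒳 : IsUpperSet 𝒳) (huniv : Set.univ ∈ 𝒳) :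
    pr q (exoneB β ∩ hat (aboH β) 𝒳) = pr q ({Set.univ} : Set (Set (Fin k))) * bsum (aX q β 𝒳) := by
  have hu : Set.univ ∈ hat (aboH β) 𝒳 := by rw [hat_aboH β hm h𝒳]; exact univ_mem_iInter_sec β huniv
  rw [pr_exoneB_inter q β hu, pr_aboH_inter_hat_eq β hq hm h𝒳 huniv]; ring

/-- `θ = μ(aboH) = W(1 + Σ r_i)`. [this work] -/
theorem pr_aboH_eq (hm : 0 < m) : pr q (aboH β) = pr q ({Set.univ} : Set (Set (Fin k))) * (1 + bsum (rB q β)) := by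
  have h := pr_aboH_inter_hat_eq β hq hm (𝒳 := Set.univ) isUpperSet_univ (Set.mem_univ _)
  rwa [aX_univ, hat_aboH β hm isUpperSet_univ, show (⋂ l ∈ (univ : Finset (Fin m)), sec β l (Set.univ : Set (Set (Fin k)))) = Set.univ
    from by simp [sec_univ], Set.inter_univ] at h

/-- `π = μ(exoneB) = W · Σ r_i`. [this work] -/
theorem pr_exoneB_eq (hm : 0 < m) : pr q (exoneB β) = pr q ({Set.univ} : Set (Set (Fin k))) * bsum (rB q β) := by
  have h := pr_exoneB_inter q β (𝒴 := Set.univ) (Set.mem_univ _)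
  rw [Set.inter_univ, Set.inter_univ] at h
  rw [h, pr_aboH_eq β hq hm]; ring

/-- The states of nonempty up-sets are admissible: `0 ≤ a_i ≤ r_i`, and for a pair Harris gives `(1+a_i)(1+b_i) ≤ (1+c_i)(1+r_i)`. [this work] -/
theorem adm_aX {𝒳 𝒵 : Set (Set (Fin k))} (h𝒳 : IsUpperSet 𝒳) (h𝒵 : IsUpperSet 𝒵) (hXu : Set.univ ∈ 𝒳) (hZu : Set.univ ∈ 𝒵)
    (i : Fin m) : Adm (rB q β i) (aX q β 𝒳 i) (aX q β 𝒵 i) (aX q β (𝒳 ∩ 𝒵) i) := by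
  have hP := prB_pos β hq i
  have hx : pr q (cylB β i) ≤ pr q (sec β i 𝒳) := pr_mono q (cylB_subset_sec β i hXu)
  have hz : pr q (cylB β i) ≤ pr q (sec β i 𝒵) := pr_mono q (cylB_subset_sec β i hZu)
  have hy : pr q (cylB β i) ≤ pr q (sec β i (𝒳 ∩ 𝒵)) := pr_mono q (cylB_subset_sec β i ⟨hXu, hZu⟩)
  have hx1 := pr_le_one q (sec β i 𝒳)
  have hz1 := pr_le_one q (sec β i 𝒵)
  have hH : pr q (sec β i 𝒳) * pr q (sec β i 𝒵) ≤ pr q (sec β i (𝒳 ∩ 𝒵)) :=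
    pr_mul_pr_le_pr_inter q (isUpperSet_sec β i h𝒳) (isUpperSet_sec β i h𝒵)
  refine ⟨?_, ?_, ?_, ?_, ?_, ?_⟩
  · rw [aX, sub_nonneg, le_div_iff₀ hP, one_mul]; exact hx
  · rw [aX, rB]; gcongr
  · rw [aX, sub_nonneg, le_div_iff₀ hP, one_mul]; exact hz
  · rw [aX, rB]; gcongr
  · rw [aX, sub_nonneg, le_div_iff₀ hP, one_mul]; exact hy
  · rw [aX, aX, aX, rB]
    have e1 : (1 + (pr q (sec β i 𝒳) / pr q (cylB β i) - 1)) * (1 + (pr q (sec β i 𝒵) / pr q (cylB β i) - 1)) =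
        (pr q (sec β i 𝒳) * pr q (sec β i 𝒵)) / (pr q (cylB β i) * pr q (cylB β i)) := by field_simp; ring
    have e2 : (1 + (pr q (sec β i (𝒳 ∩ 𝒵)) / pr q (cylB β i) - 1)) * (1 + (1 / pr q (cylB β i) - 1)) =
        pr q (sec β i (𝒳 ∩ 𝒵)) / (pr q (cylB β i) * pr q (cylB β i)) := by field_simp; ring
    rw [e1, e2]
    exact div_le_div_of_nonneg_right hH (by positivity)

set_option maxHeartbeats 1600000 in
/-- **THE ALL-BLOCKS-BUT-ONE CERTIFICATE.**  For interior parameters and a nonempty block structure,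
`ρ = μ(· | exactly one block not open)` is a reduced transport certificate of `aboH β`. [this work] -/
theorem rhoCert_aboH (hk : 0 < k) : RhoCert q (aboH β) (rhoB q β) := by
  have hm : 0 < m := Fin.pos (β ⟨0, hk⟩)
  have hr0 : ∀ i, 0 ≤ rB q β i := rB_nonneg β hq
  have hσ : 0 < bsum (rB q β) := bsum_rB_pos β hq hk
  have hWP : pr q ({Set.univ} : Set (Set (Fin k))) * bprod (rB q β) = 1 := top_mul_bprod β hq
  have hPi : 0 < bprod (rB q β) := bprod_pos _ hr0
  have hW : 0 < pr q ({Set.univ} : Set (Set (Fin k))) := by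
    by_contra h; push Not at h; nlinarith [hWP]
  have hθ := pr_aboH_eq β hq hm
  have hπ := pr_exoneB_eq β hq hm
  have hπpos : 0 < pr q (exoneB β) := by rw [hπ]; exact mul_pos hW hσ
  have hθ1 : pr q (aboH β) ≤ 1 := pr_le_one q _
  refine rhoCert_of_hat (isUpperSet_aboH β) (fun T => ?_) (fun T hT => ?_) ?_ (fun T => ?_) (fun 𝒯 h𝒯 => ?_) (fun 𝒳 𝒵 h𝒳 h𝒵 => ?_)
  · exact div_nonneg (mul_nonneg (bw_nonneg q T) (ind_nonneg _ T)) (pr_nonneg q _)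
  · rw [rhoB, ind_of_not_mem (fun h : T ∈ exoneB β => hT h.2), mul_zero, zero_div]
  · have h := sum_rhoB_ind q β Set.univ
    simp only [ind_of_mem (Set.mem_univ _), mul_one, Set.inter_univ] at h
    rw [h]; exact div_self hπpos.ne'
  · -- (a) capacity
    by_cases hT : T ∈ exoneB β
    · rw [rhoB, ind_of_mem hT, mul_one, hθ, hπ]
      have ha := SahiAllButOne.a_ineq' (pr q ({Set.univ} : Set (Set (Fin k)))) (bprod (rB q β)) (bsum (rB q β)) hσ.le hPi
        (SahiAllButOne.prod_one_add_mul_one_sub_sum_le_one univ _ fun i _ => hr0 i) hWP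
      have hcap : pr q {Set.univ} * (1 + bsum (rB q β)) * (1 - pr q {Set.univ} * (1 + bsum (rB q β))) / (pr q {Set.univ} * bsum (rB q β))
          ≤ 2 - pr q {Set.univ} * (1 + bsum (rB q β)) := by
        rw [div_le_iff₀ (mul_pos hW hσ)]; exact ha
      rw [← mul_div_assoc, mul_div_right_comm]
      exact mul_le_mul_of_nonneg_right hcap (bw_nonneg q T)
    · rw [rhoB, ind_of_not_mem hT, mul_zero, zero_div, mul_zero]
      exact mul_nonneg (by linarith) (bw_nonneg q T)
  · -- (o) domination on trace-maximal families
    by_cases hne : 𝒯.Nonempty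
    · have huniv : Set.univ ∈ 𝒯 := by obtain ⟨ω, hω⟩ := hne; exact h𝒯 (Set.subset_univ ω) hω
      rw [sum_rhoB_ind, pr_compl_inter, pr_hat_eq β hq hm h𝒯, pr_aboH_inter_hat_eq β hq hm h𝒯 huniv,
        pr_exoneB_inter_hat_eq β hq hm h𝒯 huniv, hθ, hπ]
      have hadm := adm_aX β hq h𝒯 h𝒯 huniv huniv
      exact blocks_o_W (rB q β) (aX q β 𝒯) hr0 (fun i => ⟨(hadm i).1, (hadm i).2.1⟩) hσ _ hWP
    · rw [Set.not_nonempty_iff_eq_empty.1 hne, hat_aboH_empty, Set.inter_empty, SahiTransportCert.pr_empty]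
      exact mul_nonneg (by linarith) (sum_nonneg fun T _ => by rw [ind_of_not_mem (Set.notMem_empty T), mul_zero])
  · -- (TC) on pairs of trace-maximal families
    by_cases hne : 𝒳.Nonempty ∧ 𝒵.Nonempty
    · obtain ⟨hX, hZ⟩ := hne
      have hXu : Set.univ ∈ 𝒳 := h𝒳 (Set.subset_univ _) hX.some_mem
      have hZu : Set.univ ∈ 𝒵 := h𝒵 (Set.subset_univ _) hZ.some_mem
      have h𝒳𝒵 : IsUpperSet (𝒳 ∩ 𝒵) := h𝒳.inter h𝒵
      rw [sum_rhoB_ind, tcRHS_eq, ← hat_inter, pr_exoneB_inter_hat_eq β hq hm h𝒳𝒵 ⟨hXu, hZu⟩,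
        pr_aboH_inter_hat_eq β hq hm h𝒳𝒵 ⟨hXu, hZu⟩, pr_hat_eq β hq hm h𝒳, pr_hat_eq β hq hm h𝒵,
        pr_aboH_inter_hat_eq β hq hm h𝒳 hXu, pr_aboH_inter_hat_eq β hq hm h𝒵 hZu, hθ, hπ]
      exact blocks_tc_W (rB q β) (aX q β 𝒳) (aX q β 𝒵) (aX q β (𝒳 ∩ 𝒵)) hr0 (adm_aX β hq h𝒳 h𝒵 hXu hZu) hσ _ hWP
    · rw [not_and_or, Set.not_nonempty_iff_eq_empty, Set.not_nonempty_iff_eq_empty] at hne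
      rcases hne with h | h
      · rw [h, hat_aboH_empty, Set.empty_inter, tcRHS_eq, Set.empty_inter, Set.inter_empty, SahiTransportCert.pr_empty]
        simp only [ind_of_not_mem (Set.notMem_empty _), mul_zero, sum_const_zero, zero_mul, sub_zero, add_zero]
        exact le_rfl
      · rw [h, hat_aboH_empty, Set.inter_empty, tcRHS_eq, Set.inter_empty, Set.inter_empty, SahiTransportCert.pr_empty]
        simp only [ind_of_not_mem (Set.notMem_empty _), mul_zero, sum_const_zero, zero_mul, sub_zero, add_zero]
        exact le_rfl

end Cert

/-! ### Kahn's Conjecture 5 / Sahi's `C₃` for the all-blocks-but-one first slot -/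

/-- **KAHN'S CONJECTURE 5 / SAHI'S `C₃` WHEN THE FIRST SLOT IS "ALL BUT AT MOST ONE OF THE DISJOINT CYLINDERS HOLD"** (pattern form).
For a block `e : Fin k ↪ ι` (`k ≥ 1`) with interior parameters, a block assignment `β : Fin k → Fin m`, an increasing event `H` determined
by the block whose pattern event is `aboH β`, and ALL increasing `U, V ⊆ 2^ι`: `E₃(1_H, 1_U, 1_V) ≥ 0`. [this work] -/
theorem sahiE_three_nonneg_of_aboH {ι : Type} [Fintype ι] (p : ι → unitInterval) (e : Fin k ↪ ι) (hk : 0 < k)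
    (hp : ∀ i, 0 < (p (e i) : ℝ) ∧ (p (e i) : ℝ) < 1) (β : Fin k → Fin m) {H : Set (Set ι)} (hH : DeterminedBy H (Set.range e))
    (hpat : pat e H = aboH β) {U V : Set (Set ι)} (hU : IsUpperSet U) (hV : IsUpperSet V) :
    0 ≤ sahiE (bernoulliWeight p) 3 ![ind H, ind U, ind V] := by
  have hq : ∀ i, 0 < (pk e p i : ℝ) ∧ (pk e p i : ℝ) < 1 := hp
  have hc : RhoCert (pk e p) (pat e H) (rhoB (pk e p) β) := by rw [hpat]; exact rhoCert_aboH β hq hk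
  exact sahiE_three_nonneg_of_rhoCert p e hH hc hU hV

end SahiBlocksAllButOne

end Summit.CriticalPhenomena.PercolationContinuityZ3.Theorems
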